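import Summits.QuantumFields.QCD.Theorems.WilsonMobilityGapChiralMobilityGapAnchorScope

/-!
# Crux `ChiralMobilityGap` (stmt-QuantumFields-17497) — line `Ideator3Sketch`, glue stub B
# `stub_lowerWithOfMoments`: clause (iii) with its rate on the diagonal from a FIRST-moment floor
# and no `(1,2)`-broadening

Pure probability under the phase-quenched probability measure `qcdLatticeMeasure`, any regularisation,
`N_f ≥ 2` identical flavours.  With `X ≥ 0` the quark-propagator entry sum, `A = E₊[X]`, `B = E₊[X²]`,
`M = E₊[X^s]` (`0 < s < 1`):

* `rpow_moment_ge_of_second_moment` — abstract probability: Hölder interpolation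
  `E[X] ≤ E[X^s]^{1/(2-s)} E[X²]^{(1-s)/(2-s)}` (the landed `moment_interpolation` applied to `X^{1/2}` with
  exponents `(2s, 2, 4)`), rearranged with `B ≤ K A²`, `A > 0`, to `K^{s-1} A^s ≤ M`;
* `fm_ge_of_fm_one_two` — hence, the squared entry sum being phase-quenched integrable at a degenerate
  tuple with `N_f ≥ 2` (`(Σ g)² ≤ 144 Σ g²` and the landed integrability of `Σ|G|²`, as in
  `stub_momentCompare`; private copy of glue stub A's `integrable_propSum_sq`), `K^{s-1} fm(1)^s ≤ fm(s)`
  whenever `fm(2) ≤ K fm(1)²` and `fm(1) > 0`;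
* `stub_lowerWithOfMoments` — the registered glue stub: a floor `c e^{-(μ a_k n + q log(n+1))} ≤ fm(1)` and
  no broadening `fm(2) ≤ K e^{q' log(n+1)} fm(1)²` along a degenerate trajectory give
  `LowerWith reg (t,…,t) (1/2) (K^{-1/2} c^{1/2}) (μ/2) (q/2 + q'/2)`.
-/

noncomputable section

namespace Summit.QuantumFields.QCD.Theorems.ChiralMobilityGapAnchor

open scoped BigOperators Topology
open MeasureTheory Filter Set
open Literature.MathematicalPhysics.QuantumFieldTheory Literature.MathematicalPhysics.QuantumLattice
  Literature.Probability.LatticeModels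
open Summit.QuantumFields.QCD.Theorems.MobilityGapNegative (bare fm ClauseI Upper Lower Sign Clauses)
open Summit.QuantumFields.QCD.Theorems.ChiralMobilityGapSketch (LowerWith VanishingChiralRate lower_iff)
open Summit.QuantumFields.QCD.Theorems.MobilityGapSketch (propSum propSum_nonneg measurable_propSum
  fm_eq_integral negativeFm_eq_fm)
open Summit.QuantumFields.QCD.Theorems.MobilityGapPinch (moment_interpolation)

variable {Nf : ℕ}

/-! ### §1 Abstract probability: fractional moments from the first and second -/

/-- **Fractional moments from the first moment when the second does not broaden.** On a probability
space, for `X ≥ 0` measurable with `X²` integrable, `E[X²] ≤ K · E[X]²` (`K > 0`) and `E[X] > 0`: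
`K^{s-1} · E[X]^s ≤ E[X^s]` for every `0 < s < 1` (Hölder interpolation
`E[X] ≤ E[X^s]^{1/(2-s)} E[X²]^{(1-s)/(2-s)}` — the landed `moment_interpolation` for `X^{1/2}` with
exponents `(2s, 2, 4)` — rearranged). -/
theorem rpow_moment_ge_of_second_moment {α : Type*} [MeasurableSpace α] {μ : Measure α}
    [IsProbabilityMeasure μ] {X : α → ℝ} (hX : Measurable X) (hX0 : ∀ a, 0 ≤ X a) {s : ℝ}
    (hs : 0 < s) (hs1 : s < 1) (hint : Integrable (fun a => X a ^ (2 : ℝ)) μ) {K : ℝ} (hK : 0 < K)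
    (hNB : ∫ a, X a ^ (2 : ℝ) ∂μ ≤ K * (∫ a, X a ^ (1 : ℝ) ∂μ) ^ (2 : ℝ))
    (hpos : 0 < ∫ a, X a ^ (1 : ℝ) ∂μ) :
    K ^ (s - 1) * (∫ a, X a ^ (1 : ℝ) ∂μ) ^ s ≤ ∫ a, X a ^ s ∂μ := by
  have h2s : 0 < 2 - s := by linarith
  have h1s : 0 < 1 - s := by linarith
  have h42s : 0 < 4 - 2 * s := by linarith
  -- interpolation for `Y = X^{1/2}` with exponents `(2s, 2, 4)`
  set Y : α → ℝ := fun a => X a ^ (1 / 2 : ℝ) with hY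
  have hY0 : ∀ a, 0 ≤ Y a := fun a => Real.rpow_nonneg (hX0 a) _
  have hYm : Measurable Y := hX.pow_const _
  have hYpow : ∀ (a : α) (r : ℝ), Y a ^ r = X a ^ (r / 2) := fun a r => by
    rw [hY]
    simp only
    rw [← Real.rpow_mul (hX0 a)]
    congr 1
    ring
  have hY4 : (fun a => Y a ^ (4 : ℝ)) = fun a => X a ^ (2 : ℝ) := by
    funext a; rw [hYpow]; norm_num
  have hY2 : (fun a => Y a ^ (2 : ℝ)) = fun a => X a ^ (1 : ℝ) := by
    funext a; rw [hYpow]; norm_num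
  have hY2s : (fun a => Y a ^ (2 * s)) = fun a => X a ^ s := by
    funext a; rw [hYpow]; congr 1; ring
  have hintY : Integrable (fun a => Y a ^ (4 : ℝ)) μ := by rw [hY4]; exact hint
  have hI := moment_interpolation hYm hY0 (by linarith : 0 < 2 * s) (by linarith : 2 * s < 2)
    (by norm_num : (2 : ℝ) < 4) hintY
  rw [hY4, hY2, hY2s] at hI
  have he1 : ((4 : ℝ) - 2) / (4 - 2 * s) = 1 / (2 - s) := by
    rw [div_eq_div_iff h42s.ne' h2s.ne']; ring
  have he2 : ((2 : ℝ) - 2 * s) / (4 - 2 * s) = (1 - s) / (2 - s) := by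
    rw [div_eq_div_iff h42s.ne' h2s.ne']; ring
  rw [he1, he2] at hI
  set M1 : ℝ := ∫ a, X a ^ (1 : ℝ) ∂μ with hM1
  set Ms : ℝ := ∫ a, X a ^ s ∂μ with hMs
  set M2 : ℝ := ∫ a, X a ^ (2 : ℝ) ∂μ with hM2
  have hMs0 : 0 ≤ Ms := integral_nonneg fun a => Real.rpow_nonneg (hX0 a) _
  have hM20 : 0 ≤ M2 := integral_nonneg fun a => Real.rpow_nonneg (hX0 a) _
  -- `Ms > 0` (else `M1 ≤ 0`)
  have hMs_pos : 0 < Ms := by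
    rcases hMs0.lt_or_eq with h | h
    · exact h
    · exfalso
      rw [← h, Real.zero_rpow (one_div_pos.2 h2s).ne', zero_mul] at hI
      exact absurd hI (not_le.2 hpos)
  -- raise to the power `2 - s`: `M1^{2-s} ≤ Ms · M2^{1-s}`
  have hI2 : M1 ^ (2 - s) ≤ Ms * M2 ^ (1 - s) := by
    have h := Real.rpow_le_rpow hpos.le hI h2s.le
    have hrhs : (Ms ^ (1 / (2 - s)) * M2 ^ ((1 - s) / (2 - s))) ^ (2 - s) = Ms * M2 ^ (1 - s) := by
      rw [Real.mul_rpow (Real.rpow_nonneg hMs0 _) (Real.rpow_nonneg hM20 _),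
        ← Real.rpow_mul hMs0, ← Real.rpow_mul hM20, one_div_mul_cancel h2s.ne',
        div_mul_cancel₀ _ h2s.ne', Real.rpow_one]
    rwa [hrhs] at h
  -- no broadening: `M2^{1-s} ≤ K^{1-s} M1^{2(1-s)}`
  have hNB2 : M2 ^ (1 - s) ≤ K ^ (1 - s) * M1 ^ (2 * (1 - s)) := by
    have h := Real.rpow_le_rpow hM20 hNB h1s.le
    rwa [Real.mul_rpow hK.le (Real.rpow_nonneg hpos.le _), ← Real.rpow_mul hpos.le] at h
  -- combine and divide
  have hcomb : M1 ^ (2 - s) ≤ Ms * (K ^ (1 - s) * M1 ^ (2 * (1 - s))) :=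
    hI2.trans (mul_le_mul_of_nonneg_left hNB2 hMs0)
  have hD : 0 < K ^ (1 - s) * M1 ^ (2 * (1 - s)) :=
    mul_pos (Real.rpow_pos_of_pos hK _) (Real.rpow_pos_of_pos hpos _)
  have hkey : M1 ^ (2 - s) / (K ^ (1 - s) * M1 ^ (2 * (1 - s))) ≤ Ms := by
    rw [div_le_iff₀ hD]; exact hcomb
  -- identify the left-hand side with `K^{s-1} M1^s`
  have hL : M1 ^ (2 - s) / (K ^ (1 - s) * M1 ^ (2 * (1 - s))) = K ^ (s - 1) * M1 ^ s := by
    rw [div_eq_iff hD.ne']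
    symm
    have hK2 : K ^ (s - 1) * K ^ (1 - s) = 1 := by
      rw [← Real.rpow_add hK]; norm_num
    have hM : M1 ^ s * M1 ^ (2 * (1 - s)) = M1 ^ (2 - s) := by
      rw [← Real.rpow_add hpos]; congr 1; ring
    calc K ^ (s - 1) * M1 ^ s * (K ^ (1 - s) * M1 ^ (2 * (1 - s)))
        = (K ^ (s - 1) * K ^ (1 - s)) * (M1 ^ s * M1 ^ (2 * (1 - s))) := by ring
      _ = M1 ^ (2 - s) := by rw [hK2, hM, one_mul]
  rwa [hL] at hkey

/-! ### §2 `fm(s) ≥ K^{s-1} fm(1)^s` at a degenerate tuple -/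

/-- The squared entry sum is phase-quenched integrable at a degenerate tuple with `N_f ≥ 2`
(`(Σ g)² ≤ 144 Σ g²` configuration-wise, `MobilityGapPinch.sum_sq_le_sq_sum_le`, and the landed
integrability of the pion weight `Σ|G|²`, `integrable_sum_norm_inv_diracMatrix_sq`) — a private copy of
glue stub A's `integrable_propSum_sq`, kept local so that the two glue files are independent. -/
private theorem integrable_propSum_sq_aux (hNf : 2 ≤ Nf) (S : ℕ) (β t : ℝ) (f : Fin Nf) (v : Site 4) :
    Integrable (fun U : GaugeConfig 4 (2 * S + 1) SU3 => propSum Nf S (fun _ => t) f v U ^ (2 : ℝ))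
      (qcdLatticeMeasure (2 * S + 1) β (fun _ : Fin Nf => t)) := by
  have hP0 := propSum_nonneg Nf S (fun _ : Fin Nf => t) f v
  have hXi := ChiralMobilityGapSketch.integrable_sum_norm_inv_diracMatrix_sq (S := 2 * S + 1) hNf β t f
    (Torus.proj (2 * S + 1) 0) (Torus.proj (2 * S + 1) v)
  have hPX : ∀ U : GaugeConfig 4 (2 * S + 1) SU3, propSum Nf S (fun _ : Fin Nf => t) f v U ^ (2 : ℝ) ≤
      144 * ∑ a : Fin 3, ∑ i : Fin 4, ∑ b : Fin 3, ∑ j : Fin 4,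
        ‖(diracMatrix U (fun _ : Fin Nf => t))⁻¹ (quarkEquiv (f, (Torus.proj (2 * S + 1) 0, a, i)))
          (quarkEquiv (f, (Torus.proj (2 * S + 1) v, b, j)))‖ ^ (2 : ℕ) := fun U => by
    rw [Real.rpow_two]
    exact (MobilityGapPinch.sum_sq_le_sq_sum_le (fun a i b j =>
      ‖(diracMatrix U (fun _ : Fin Nf => t))⁻¹ (quarkEquiv (f, (Torus.proj (2 * S + 1) 0, a, i)))
        (quarkEquiv (f, (Torus.proj (2 * S + 1) v, b, j)))‖) fun _ _ _ _ => norm_nonneg _).2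
  exact Integrable.mono' (hXi.const_mul 144)
    ((measurable_propSum Nf S (fun _ : Fin Nf => t) f v).pow_const _).aestronglyMeasurable
    (Eventually.of_forall fun U => by
      rw [Real.norm_eq_abs, abs_of_nonneg (Real.rpow_nonneg (hP0 U) _)]
      exact hPX U)

/-- **Fractional moments of the clause functional from its first and second moments** (degenerate
tuple, `N_f ≥ 2`, `0 < s < 1`): if `fm(2) ≤ K · fm(1)²` with `K > 0` and `fm(1) > 0` then
`K^{s-1} · fm(1)^s ≤ fm(s)` — all three are moments of the entry sum `X` under the phase-quenched
probability measure `qcdLatticeMeasure`. -/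
theorem fm_ge_of_fm_one_two (hNf : 2 ≤ Nf) (β t : ℝ) (S : ℕ) (f : Fin Nf) (v : Site 4) {s : ℝ}
    (hs : 0 < s) (hs1 : s < 1) {K : ℝ} (hK : 0 < K)
    (hNB : fm Nf β (fun _ => t) S f v 2 ≤ K * fm Nf β (fun _ => t) S f v 1 ^ (2 : ℝ))
    (hpos : 0 < fm Nf β (fun _ => t) S f v 1) :
    K ^ (s - 1) * fm Nf β (fun _ => t) S f v 1 ^ s ≤ fm Nf β (fun _ => t) S f v s := by
  haveI := isProbabilityMeasure_qcdLatticeMeasure_all (S := 2 * S + 1) β (fun _ : Fin Nf => t)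
  rw [negativeFm_eq_fm] at *
  simp only [fm_eq_integral] at hNB hpos ⊢
  exact rpow_moment_ge_of_second_moment (measurable_propSum Nf S _ f v) (propSum_nonneg Nf S _ f v) hs hs1
    (integrable_propSum_sq_aux hNf S β t f v) hK hNB hpos

/-! ### §3 The registered glue stub: clause (iii) with its rate on the diagonal -/

/-- GLUE STUB B.  **Clause (iii) with rate on the diagonal from a first-moment floor and no
`(1,2)`-broadening** (`N_f ≥ 2`, any regularisation).  If eventually in `k`, on every torus `S ≥ L_k`,
for every flavour and every `n ≤ S`, `c e^{-(μ a_k n + q log(n+1))} ≤ fm(1)` (`c > 0`) and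
`fm(2) ≤ K e^{q' log(n+1)} fm(1)²` (`K > 0`), then
`LowerWith reg (t,…,t) (1/2) (K^{-1/2} c^{1/2}) (μ/2) (q/2 + q'/2)`: by `fm_ge_of_fm_one_two` at `s = 1/2`,
`fm(1/2) ≥ K_n^{-1/2} fm(1)^{1/2}` with `K_n = K e^{q' log(n+1)}`, and the exponentials are collected. -/
theorem stub_lowerWithOfMoments : ∀ {Nf : ℕ}, 2 ≤ Nf → ∀ (reg : QCDRegularisation Nf) (t : ℝ)
    {c μ q K q' : ℝ}, 0 < c → 0 < K →
    (∀ᶠ k in atTop, ∀ S : ℕ, reg.L k ≤ S → ∀ (f : Fin Nf) (n : ℕ), n ≤ S →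
      c * Real.exp (-(μ * (reg.a k * n) + q * Real.log (n + 1))) ≤
        fm Nf (reg.β k) (bare reg (fun _ => t) k) S f (Pi.single 0 (n : ℤ)) 1) →
    (∀ᶠ k in atTop, ∀ S : ℕ, reg.L k ≤ S → ∀ (f : Fin Nf) (n : ℕ), n ≤ S →
      fm Nf (reg.β k) (bare reg (fun _ => t) k) S f (Pi.single 0 (n : ℤ)) 2 ≤
        K * Real.exp (q' * Real.log (n + 1)) *
          fm Nf (reg.β k) (bare reg (fun _ => t) k) S f (Pi.single 0 (n : ℤ)) 1 ^ (2 : ℝ)) →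
    LowerWith reg (fun _ => t) (1 / 2) (K ^ (-(1 / 2 : ℝ)) * c ^ (1 / 2 : ℝ)) (μ / 2) (q / 2 + q' / 2) := by
  intro Nf hNf reg t c μ q K q' hc hK hPF hNB
  filter_upwards [hPF, hNB] with k hPFk hNBk S hS f n hn
  -- read the two inputs at the constant tuple `x_k = m_crit(k) + a_k t / Z_m(k)`
  have h1 : c * Real.exp (-(μ * (reg.a k * n) + q * Real.log (n + 1))) ≤
      fm Nf (reg.β k) (fun _ : Fin Nf => reg.mcrit k + reg.a k * t / reg.Zm k) S f (Pi.single 0 (n : ℤ)) 1 :=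
    hPFk S hS f n hn
  have h2 : fm Nf (reg.β k) (fun _ : Fin Nf => reg.mcrit k + reg.a k * t / reg.Zm k) S f (Pi.single 0 (n : ℤ)) 2 ≤
      (K * Real.exp (q' * Real.log (n + 1))) *
        fm Nf (reg.β k) (fun _ : Fin Nf => reg.mcrit k + reg.a k * t / reg.Zm k) S f (Pi.single 0 (n : ℤ)) 1 ^
          (2 : ℝ) :=
    hNBk S hS f n hn
  have hKn : 0 < K * Real.exp (q' * Real.log (n + 1)) := mul_pos hK (Real.exp_pos _)
  have hE0 : 0 < c * Real.exp (-(μ * (reg.a k * n) + q * Real.log (n + 1))) := mul_pos hc (Real.exp_pos _)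
  have hF1pos : 0 < fm Nf (reg.β k) (fun _ : Fin Nf => reg.mcrit k + reg.a k * t / reg.Zm k) S f
      (Pi.single 0 (n : ℤ)) 1 := hE0.trans_le h1
  have hmain := fm_ge_of_fm_one_two hNf (reg.β k) (reg.mcrit k + reg.a k * t / reg.Zm k) S f
    (Pi.single 0 (n : ℤ)) (by norm_num : (0 : ℝ) < 1 / 2) (by norm_num : (1 / 2 : ℝ) < 1) hKn h2 hF1pos
  refine le_trans ?_ hmain
  -- constants: `K^{-1/2} c^{1/2} e^{-((μ/2) a n + (q/2 + q'/2) log(n+1))} = Kn^{-1/2} (c e^{…})^{1/2}`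
  have hstep : (c * Real.exp (-(μ * (reg.a k * n) + q * Real.log (n + 1)))) ^ (1 / 2 : ℝ) ≤
      fm Nf (reg.β k) (fun _ : Fin Nf => reg.mcrit k + reg.a k * t / reg.Zm k) S f (Pi.single 0 (n : ℤ)) 1 ^
        (1 / 2 : ℝ) :=
    Real.rpow_le_rpow hE0.le h1 (by norm_num)
  refine le_trans (le_of_eq ?_) (mul_le_mul_of_nonneg_left hstep (Real.rpow_nonneg hKn.le _))
  rw [show (1 / 2 : ℝ) - 1 = -(1 / 2 : ℝ) by norm_num,
    Real.mul_rpow hK.le (Real.exp_pos _).le, Real.mul_rpow hc.le (Real.exp_pos _).le,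
    ← Real.exp_mul, ← Real.exp_mul]
  have hexp : Real.exp (-(μ / 2 * (reg.a k * n) + (q / 2 + q' / 2) * Real.log (n + 1))) =
      Real.exp (q' * Real.log (n + 1) * (-(1 / 2 : ℝ))) *
        Real.exp (-(μ * (reg.a k * n) + q * Real.log (n + 1)) * (1 / 2 : ℝ)) := by
    rw [← Real.exp_add]
    congr 1
    ring
  rw [hexp]
  ring

end Summit.QuantumFields.QCD.Theorems.ChiralMobilityGapAnchor

end
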